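import Mathlib
import HarnessLib
import Summits.AtomisticToContinuum.FouriersLaw.Theses.JunctionLocality
import Summits.AtomisticToContinuum.FouriersLaw.Theses.BoundaryEscapeDeficit
import Summits.AtomisticToContinuum.FouriersLaw.Theorems.JunctionLocalitySuperadditiveResistanceStubLinearResponsePlainAux1
import Summits.AtomisticToContinuum.FouriersLaw.Theorems.JunctionLocalitySuperadditiveResistanceStubPlainKuboLinkAux3
import Summits.AtomisticToContinuum.FouriersLaw.Theorems.JunctionLocalitySuperadditiveResistanceKuboLimit

/-!
# The Kubo link of the plain chain's response field, and `stub_linearResponsePlain` from `ResponseIdentity`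
(stub `stub_linearResponsePlain` of line `thermalise-then-cut-probe-insertion`, crux stmt-AtomisticToContinuum-11748)

Helper file 2 (`--supports` stmt-AtomisticToContinuum-11748). Clause 3 of the line's `PlainFrame` is the
finite-volume linear-response formula `D_L/(L−1) = γ(1/2 − ⟨p_0² − T, h⟩_{μ_T})` for the response field
`h` of the plain `L`-chain (helper 1, `…StubLinearResponsePlainAux1`: existence and a.e.-uniqueness).
This file proves everything on the EQUILIBRIUM side and pins the NESS side on the open route item
`BoundaryEscapeDeficit.ResponseIdentity` (stmt-AtomisticToContinuum-12237):

* `hamiltonian_bathWeight_pair` — `X_H H = 0`, `γ S H = −γ((p_0² − T) + (p_{L−1}² − T))`: the energy is a classical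
  forward field of the sum of the two bath observables (for both signs of `X_H`);
* `sum_rule` — `γ⟨g₀, (p_0² − T) + (p_{L−1}² − T)⟩_{μ_T} = T²` for every classical forward field `g₀` of
  the left bath (cross Green identity `cross` with `H`, and `⟨p_0² − T, H⟩_{μ_T} = T²`);
* `kuboPairing_classical`, `kuboPairing_responseField` — for every weak `L²(μ_T)` response field `h`:
  `⟨p_0² − T, h⟩_{μ_T} = (γ/T²)⟨g₀, p_0² − T⟩_{μ_T} − 1/2` (cross Green identity `⟨h, p_0² − T⟩ = ⟨g₀, W⟩`
  for the classical reversed field of helper 1, sum rule, a.e.-uniqueness), i.e. the line's response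
  coefficient `γ(1/2 − ⟨p_0² − T, h⟩)` IS the sibling line's Kubo conductance `γ(1 − (γ/T²)⟨g₀, p_0² − T⟩)`;
* `responseCoefficient_eq_escapeDeficit` — `= γE_L`, `E_L = 1 − (γ/T²)∫₀^∞ K_L` the escape deficit of route
  `BoundaryEscapeDeficit` (Green–Kubo identification `greenKubo_forwardField`);
* `plainFrame_of_responseIdentityAt` — under the crux frame, the conclusion of `ResponseIdentity` AT
  LENGTH `L` (`totalCurrent(μ_{L,T+δ/2,T−δ/2})/δ → (L−1)γE_L`) gives `∃ h, PlainFrame … h (D_L/(L−1))`;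
* `linearResponsePlain_of_responseIdentity` (registered sub-goal
  `helper_linearResponsePlainOfResponseIdentity`) — `ResponseIdentity →` the registered stub
  `stub_linearResponsePlain`, verbatim. The stub is thereby exactly stmt-12237 read through this file.

References: Rey-Bellet (2003), Rem. 4.4; Kundu–Dhar–Narayan, J. Stat. Mech. (2009) L03001
(open-system Green–Kubo); Eckmann–Pillet–Rey-Bellet, CMP 201 (1999) §3.
-/

noncomputable section

open MeasureTheory Filter Topology ProbabilityTheory Set
open scoped ContDiff NNReal
open Literature.MathematicalPhysics.KineticTheory.HeatConduction
open Literature.MathematicalPhysics.KineticTheory OscillatorChain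
open Summit.AtomisticToContinuum.FouriersLaw.Theorems.SubdiffusiveBondHeat
open Summit.AtomisticToContinuum.FouriersLaw.Theorems.SuperadditiveResistance.DeviceLiouville
  (liouvilleOp bathOp generator_eq_liouvilleOp_add kin_eq_sq)
open Summit.AtomisticToContinuum.FouriersLaw.Theorems.SuperadditiveResistance.Kubo
  (memLp_kinetic memLp_hamiltonian cross integral_kinetic_mul_hamiltonian_mul_gibbsDensity
    integrable_mul_mul_gibbsDensity)
open Summit.AtomisticToContinuum.FouriersLaw.Cruxes.SuperadditiveResistance.FloatingProbeBypassLaplacian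
  (greenKubo_forwardField plainForwardFields)

namespace Summit.AtomisticToContinuum.FouriersLaw.Cruxes.SuperadditiveResistance.ThermaliseThenCutProbeInsertion

/-! ## The Hamiltonian as a forward field: `L_{T,T} H = −γ((p_0² − T) + (p_{L−1}² − T))` -/

section Hamiltonian

variable (P : OscillatorChain) {L : ℕ}

/-- `X_H H = 0`. -/
theorem liouvilleOp_hamiltonian (x : PhaseSpace L) : liouvilleOp P L (P.hamiltonian L) x = 0 := by
  unfold liouvilleOp
  refine Finset.sum_eq_zero fun i _ => ?_
  rw [P.partialP_hamiltonian]
  ring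

/-- `S_{bathWeight} H = (T − p_0²) + (T − p_{L−1}²)` (`L ≥ 1`; `∂_{p_i} H = p_i`, `∂²_{p_i} H = 1`). -/
theorem bathOp_bathWeight_hamiltonian (hL : 0 < L) (T : ℝ) (x : PhaseSpace L) :
    bathOp L (OscillatorChain.bathWeight L) T (P.hamiltonian L) x =
      (T - x.2 ⟨0, hL⟩ ^ 2) + (T - x.2 ⟨L - 1, Nat.sub_lt hL one_pos⟩ ^ 2) := by
  unfold bathOp OscillatorChain.bathWeight
  simp only [partialP_partialP_hamiltonian P L x, P.partialP_hamiltonian, mul_one, add_mul,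
    Finset.sum_add_distrib]
  have e0 : ∀ i : Fin L, (if i.val = 0 then (1 : ℝ) else 0) * (T - x.2 i * x.2 i) =
      if i = ⟨0, hL⟩ then (T - x.2 i ^ 2) else 0 := fun i => by
    by_cases hi : i = ⟨0, hL⟩
    · subst hi; simp [sq]
    · have : i.val ≠ 0 := fun h => hi (Fin.ext h)
      simp [hi, this]
  have e1 : ∀ i : Fin L, (if i.val = L - 1 then (1 : ℝ) else 0) * (T - x.2 i * x.2 i) =
      if i = ⟨L - 1, Nat.sub_lt hL one_pos⟩ then (T - x.2 i ^ 2) else 0 := fun i => by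
    by_cases hi : i = ⟨L - 1, Nat.sub_lt hL one_pos⟩
    · subst hi; simp [sq]
    · have : i.val ≠ L - 1 := fun h => hi (Fin.ext h)
      simp [hi, this]
  simp only [e0, e1, Finset.sum_ite_eq', Finset.mem_univ, if_true]

/-- **`H` is a classical pair for both signs of `X_H`** (`X_H H = 0`): for every `σ`,
`σ X_H H + γ S_{bathWeight} H = −γ((p_0² − T) + (p_{L−1}² − T))`. -/
theorem hamiltonian_bathWeight_pair (hL : 0 < L) (T σ : ℝ) (x : PhaseSpace L) :
    σ * liouvilleOp P L (P.hamiltonian L) x + P.γ * bathOp L (OscillatorChain.bathWeight L) T (P.hamiltonian L) x =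
      -(P.γ * ((x.2 ⟨0, hL⟩ ^ 2 - T) + (x.2 ⟨L - 1, Nat.sub_lt hL one_pos⟩ ^ 2 - T))) := by
  rw [liouvilleOp_hamiltonian, bathOp_bathWeight_hamiltonian P hL]
  ring

end Hamiltonian

/-! ## The sum rule and the Kubo pairing of the response field -/

section KuboPairing

variable {ω₂ lam β γ : ℝ} {L : ℕ} {T : ℝ}
  (hω : 0 < ω₂) (hl : 0 ≤ lam) (hβ : 0 < β) (hγ : 0 < γ) (hL : 0 < L) (hT : 0 < T)
include hω hl hβ hγ hL hT

/-- **Sum rule** `γ⟨g₀, (p_0² − T) + (p_{L−1}² − T)⟩_{μ_T} = T²` for every classical forward field `g₀`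
of the left bath (`C² ∩ L²(μ_T)`, `L_{T,T} g₀ = −(p_0² − T)`): the cross Green identity (`cross`) for
the `(+1)`-pair `(g₀, p_0² − T)` and the `(−1)`-pair `(H, γ(p_0² − T + p_{L−1}² − T))`, and the
Gaussian covariance `⟨p_0² − T, H⟩_{μ_T} = T²`. -/
theorem sum_rule {g₀ : PhaseSpace L → ℝ} (hC : ContDiff ℝ 2 g₀)
    (hL2 : MemLp g₀ 2 ((pinnedChain ω₂ lam β γ).gibbsMeasure L T))
    (hpde : ∀ x, (pinnedChain ω₂ lam β γ).generator L T T g₀ x = -(kin L 0 x - T)) :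
    γ * ∫ x, g₀ x * ((x.2 ⟨0, hL⟩ ^ 2 - T) + (x.2 ⟨L - 1, Nat.sub_lt hL one_pos⟩ ^ 2 - T)) *
        (pinnedChain ω₂ lam β γ).gibbsDensity L T x =
      T ^ 2 * ∫ x, (pinnedChain ω₂ lam β γ).gibbsDensity L T x := by
  set P := pinnedChain ω₂ lam β γ with hP
  have hγ' : P.γ = γ := rfl
  have hB : ∀ i, 0 ≤ OscillatorChain.bathWeight L i := fun i => by
    unfold OscillatorChain.bathWeight; split_ifs <;> norm_num
  have hHs : ContDiff ℝ 2 (P.hamiltonian L) :=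
    (P.contDiff_hamiltonian (pinnedChain_contDiff_U ω₂ lam β γ) (pinnedChain_contDiff_V ω₂ lam β γ) L).of_le
      (by norm_cast)
  have hpf : ∀ x, 1 * liouvilleOp P L g₀ x + γ * bathOp L (OscillatorChain.bathWeight L) T g₀ x =
      -(x.2 ⟨0, hL⟩ ^ 2 - T) := fun x => by
    rw [one_mul, ← hγ', ← generator_eq_liouvilleOp_add, hpde x, (show kin L 0 x = x.2 ⟨0, hL⟩ ^ 2 from kin_eq_sq hL x)]
  have hph : ∀ x, -1 * liouvilleOp P L (P.hamiltonian L) x + γ * bathOp L (OscillatorChain.bathWeight L) T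
      (P.hamiltonian L) x = -(γ * ((x.2 ⟨0, hL⟩ ^ 2 - T) + (x.2 ⟨L - 1, Nat.sub_lt hL one_pos⟩ ^ 2 - T))) :=
    fun x => by rw [← hγ']; exact hamiltonian_bathWeight_pair P hL T (-1) x
  have hk0 : MemLp (fun x : PhaseSpace L => x.2 ⟨0, hL⟩ ^ 2 - T) 2 (P.gibbsMeasure L T) :=
    memLp_kinetic hω hl hβ.le L hT ⟨0, hL⟩
  have hk1 : MemLp (fun x : PhaseSpace L => x.2 ⟨L - 1, Nat.sub_lt hL one_pos⟩ ^ 2 - T) 2 (P.gibbsMeasure L T) :=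
    memLp_kinetic hω hl hβ.le L hT _
  have hkh : MemLp (fun x : PhaseSpace L => γ * ((x.2 ⟨0, hL⟩ ^ 2 - T) +
      (x.2 ⟨L - 1, Nat.sub_lt hL one_pos⟩ ^ 2 - T))) 2 (P.gibbsMeasure L T) := (hk0.add hk1).const_mul γ
  have hcross := cross hω hl hβ.le L hT (OscillatorChain.bathWeight L) hB 1 hγ hC hHs hL2
    (memLp_hamiltonian hω hl hβ.le L hT) hk0 hkh hpf hph
  -- `∫ H (p_0² − T) ρ = T² ∫ ρ`
  have hcov := integral_kinetic_mul_hamiltonian_mul_gibbsDensity (γ := γ) hω hl hβ.le L hT ⟨0, hL⟩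
  have e1 : ∫ x, P.hamiltonian L x * (x.2 ⟨0, hL⟩ ^ 2 - T) * P.gibbsDensity L T x =
      ∫ x, (x.2 ⟨0, hL⟩ ^ 2 - T) * P.hamiltonian L x * P.gibbsDensity L T x :=
    integral_congr_ae (ae_of_all _ fun x => by ring)
  rw [e1, hcov] at hcross
  rw [hcross, ← integral_const_mul]
  exact integral_congr_ae (ae_of_all _ fun x => by ring)

/-- **Kubo pairing of a CLASSICAL response field.** For a `C² ∩ L²(μ_T)` classical solution `h` of the
adjoint equation `−X_H h + γ S h = −W` and a classical forward field `g₀` of the left bath: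
`⟨p_0² − T, h⟩_{μ_T} = (γ/T²)⟨g₀, p_0² − T⟩_{μ_T} − 1/2` (cross Green identity `⟨h, p_0² − T⟩ = ⟨g₀, W⟩`,
`W = (γ/2T²)((p_0² − T) − (p_{L−1}² − T))`, and the sum rule). -/
theorem kuboPairing_classical {h g₀ : PhaseSpace L → ℝ} (hh : ContDiff ℝ 2 h)
    (hh2 : MemLp h 2 ((pinnedChain ω₂ lam β γ).gibbsMeasure L T))
    (hhpde : ∀ x, -liouvilleOp (pinnedChain ω₂ lam β γ) L h x +
      (pinnedChain ω₂ lam β γ).γ * bathOp L (OscillatorChain.bathWeight L) T h x =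
        -plainSource (pinnedChain ω₂ lam β γ) T L x)
    (hC : ContDiff ℝ 2 g₀) (hL2 : MemLp g₀ 2 ((pinnedChain ω₂ lam β γ).gibbsMeasure L T))
    (hpde : ∀ x, (pinnedChain ω₂ lam β γ).generator L T T g₀ x = -(kin L 0 x - T)) :
    ∫ x, (kin L 0 x - T) * h x ∂((pinnedChain ω₂ lam β γ).gibbsMeasure L T) =
      γ / T ^ 2 * ∫ x, g₀ x * (kin L 0 x - T) ∂((pinnedChain ω₂ lam β γ).gibbsMeasure L T) - 1 / 2 := by
  set P := pinnedChain ω₂ lam β γ with hP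
  have hγ' : P.γ = γ := rfl
  have hB : ∀ i, 0 ≤ OscillatorChain.bathWeight L i := fun i => by
    unfold OscillatorChain.bathWeight; split_ifs <;> norm_num
  have hZ : 0 < ∫ x, P.gibbsDensity L T x := integral_exp_pos (pinnedChain_integrable_gibbsDensity hω hl hβ.le γ L hT)
  set i₁ : Fin L := ⟨L - 1, Nat.sub_lt hL one_pos⟩ with hi₁
  have hpf : ∀ x, 1 * liouvilleOp P L g₀ x + γ * bathOp L (OscillatorChain.bathWeight L) T g₀ x =
      -(x.2 ⟨0, hL⟩ ^ 2 - T) := fun x => by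
    rw [one_mul, ← hγ', ← generator_eq_liouvilleOp_add, hpde x, (show kin L 0 x = x.2 ⟨0, hL⟩ ^ 2 from kin_eq_sq hL x)]
  have hph : ∀ x, -1 * liouvilleOp P L h x + γ * bathOp L (OscillatorChain.bathWeight L) T h x =
      -plainSource P T L x := fun x => by rw [neg_one_mul, ← hγ']; exact hhpde x
  have hk0 : MemLp (fun x : PhaseSpace L => x.2 ⟨0, hL⟩ ^ 2 - T) 2 (P.gibbsMeasure L T) :=
    memLp_kinetic hω hl hβ.le L hT ⟨0, hL⟩
  have hcross := cross hω hl hβ.le L hT (OscillatorChain.bathWeight L) hB 1 hγ hC hh hL2 hh2 hk0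
    (memLp_plainSource hω hl hβ.le hL hT) hpf hph
  -- `∫ h (p_0² − T) ρ = ∫ g₀ W ρ = (γ/2T²)(2 ∫ g₀ (p_0² − T) ρ − (T²/γ) ∫ ρ)`
  have hsum := sum_rule hω hl hβ hγ hL hT hC hL2 hpde
  have hI0 : Integrable fun x => g₀ x * (x.2 ⟨0, hL⟩ ^ 2 - T) * P.gibbsDensity L T x :=
    integrable_mul_mul_gibbsDensity hω hl hβ.le γ L hT hL2 hk0
  have hI1 : Integrable fun x => g₀ x * (x.2 i₁ ^ 2 - T) * P.gibbsDensity L T x :=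
    integrable_mul_mul_gibbsDensity hω hl hβ.le γ L hT hL2 (memLp_kinetic hω hl hβ.le L hT i₁)
  have eW : ∫ x, g₀ x * plainSource P T L x * P.gibbsDensity L T x =
      γ / (2 * T ^ 2) * ((∫ x, g₀ x * (x.2 ⟨0, hL⟩ ^ 2 - T) * P.gibbsDensity L T x) -
        ∫ x, g₀ x * (x.2 i₁ ^ 2 - T) * P.gibbsDensity L T x) := by
    rw [← integral_sub hI0 hI1, ← integral_const_mul]
    refine integral_congr_ae (ae_of_all _ fun x => ?_)
    rw [plainSource_eq P T hL]
    dsimp only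
    rw [hγ']
    ring
  have eS : ∫ x, g₀ x * (x.2 i₁ ^ 2 - T) * P.gibbsDensity L T x =
      T ^ 2 / γ * (∫ x, P.gibbsDensity L T x) - ∫ x, g₀ x * (x.2 ⟨0, hL⟩ ^ 2 - T) * P.gibbsDensity L T x := by
    have e2 : ∫ x, g₀ x * ((x.2 ⟨0, hL⟩ ^ 2 - T) + (x.2 i₁ ^ 2 - T)) * P.gibbsDensity L T x =
        (∫ x, g₀ x * (x.2 ⟨0, hL⟩ ^ 2 - T) * P.gibbsDensity L T x) +
          ∫ x, g₀ x * (x.2 i₁ ^ 2 - T) * P.gibbsDensity L T x := by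
      rw [← integral_add hI0 hI1]
      exact integral_congr_ae (ae_of_all _ fun x => by ring)
    rw [e2] at hsum
    field_simp
    linarith
  -- back to `μ_T`
  rw [P.integral_gibbsMeasure, P.integral_gibbsMeasure]
  have eL : ∫ x, (kin L 0 x - T) * h x * P.gibbsDensity L T x =
      ∫ x, h x * (x.2 ⟨0, hL⟩ ^ 2 - T) * P.gibbsDensity L T x :=
    integral_congr_ae (ae_of_all _ fun x => by
      dsimp only; rw [(show kin L 0 x = x.2 ⟨0, hL⟩ ^ 2 from kin_eq_sq hL x)]; ring)
  have eR : ∫ x, g₀ x * (kin L 0 x - T) * P.gibbsDensity L T x =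
      ∫ x, g₀ x * (x.2 ⟨0, hL⟩ ^ 2 - T) * P.gibbsDensity L T x :=
    integral_congr_ae (ae_of_all _ fun x => by
      dsimp only; rw [(show kin L 0 x = x.2 ⟨0, hL⟩ ^ 2 from kin_eq_sq hL x)])
  rw [eL, eR, hcross, eW, eS]
  field_simp
  ring

/-- **Kubo pairing of THE response field.** For every weak `L²(μ_T)` response field `h`
(`IsPlainResponseField`) and every classical forward field `g₀` of the left bath:
`⟨p_0² − T, h⟩_{μ_T} = (γ/T²)⟨g₀, p_0² − T⟩_{μ_T} − 1/2`, i.e. the line's response coefficient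
`γ(1/2 − ⟨p_0² − T, h⟩)` IS the sibling line's Kubo conductance `γ(1 − (γ/T²)⟨g₀, p_0² − T⟩)`
(a.e.-uniqueness of response fields transfers the classical pairing). -/
theorem kuboPairing_responseField {h g₀ : PhaseSpace L → ℝ}
    (hh : IsPlainResponseField (pinnedChain ω₂ lam β γ) T L h)
    (hC : ContDiff ℝ 2 g₀) (hL2 : MemLp g₀ 2 ((pinnedChain ω₂ lam β γ).gibbsMeasure L T))
    (hpde : ∀ x, (pinnedChain ω₂ lam β γ).generator L T T g₀ x = -(kin L 0 x - T)) :
    ∫ x, (kin L 0 x - T) * h x ∂((pinnedChain ω₂ lam β γ).gibbsMeasure L T) =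
      γ / T ^ 2 * ∫ x, g₀ x * (kin L 0 x - T) ∂((pinnedChain ω₂ lam β γ).gibbsMeasure L T) - 1 / 2 := by
  obtain ⟨h₁, hh₁, hL2₁, hmean₁, hpde₁⟩ := exists_classical_responseField hω hl hβ hγ hL hT
  have hh₁' : IsPlainResponseField (pinnedChain ω₂ lam β γ) T L h₁ :=
    ⟨hL2₁, hmean₁, fun f hf hfc => weak_of_classical_adjoint hT.ne' (hh₁.of_le (by norm_cast)) hpde₁ hf hfc⟩
  rw [integral_kin_mul_eq_of_isPlainResponseField hω hl hβ.le hγ hL hT hh₁' hh]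
  exact kuboPairing_classical hω hl hβ hγ hL hT (hh₁.of_le (by norm_cast)) hL2₁ hpde₁ hC hL2 hpde

/-- **The response coefficient of the line is `γ E_L`**: for every response field `h`,
`γ(1/2 − ⟨p_0² − T, h⟩_{μ_T}) = γ(1 − (γ/T²)∫₀^∞ K_L(u) du)` with the boundary kernel
`K_L(u) = ⟨p_0² − T, P_u(p_0² − T)⟩_{μ_T}` of route `BoundaryEscapeDeficit` (Green–Kubo identification
of the forward field, `greenKubo_forwardField`, and its existence, `stub_plainForwardField`). -/
theorem responseCoefficient_eq_escapeDeficit {h : PhaseSpace L → ℝ}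
    (hh : IsPlainResponseField (pinnedChain ω₂ lam β γ) T L h) :
    γ * (1 / 2 - ∫ x, (kin L 0 x - T) * h x ∂((pinnedChain ω₂ lam β γ).gibbsMeasure L T)) =
      γ * (1 - γ / T ^ 2 * ∫ u in Set.Ioi (0 : ℝ), ∫ z, (z.2 ⟨0, hL⟩ ^ 2 - T) *
        (∫ y, (y.2 ⟨0, hL⟩ ^ 2 - T) ∂((pinnedChain ω₂ lam β γ).transitionKernel L T T u.toNNReal z))
        ∂((pinnedChain ω₂ lam β γ).gibbsMeasure L T)) := by
  obtain ⟨g₀, hg₀, hL2, hmean, hpde⟩ := exists_smooth_poisson hω hl hβ hγ hL hT (K := 2 / (1 / (4 * T)) + T)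
    (k := fun y : PhaseSpace L => y.2 ⟨0, hL⟩ ^ 2 - T) (by fun_prop)
    (fun y => abs_sq_momentum_sub_le_exp (γ := γ) hω hl hβ.le (by positivity) hT.le y ⟨0, hL⟩)
    (pinnedChain_integral_kinObs_gibbsMeasure hω hl hβ.le γ L hT ⟨0, hL⟩)
  have hpde' : ∀ x, (pinnedChain ω₂ lam β γ).generator L T T g₀ x = -(kin L 0 x - T) := fun x => by
    rw [hpde x, (show kin L 0 x = x.2 ⟨0, hL⟩ ^ 2 from kin_eq_sq hL x)]
  -- the Green–Kubo identification (stated with the defeq copy `DeviceLiouville.kin` of `kin`)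
  have hGK : ∫ x, g₀ x * (kin L 0 x - T) ∂((pinnedChain ω₂ lam β γ).gibbsMeasure L T) =
      ∫ u in Set.Ioi (0 : ℝ), ∫ z, (z.2 ⟨0, hL⟩ ^ 2 - T) *
        (∫ y, (y.2 ⟨0, hL⟩ ^ 2 - T) ∂((pinnedChain ω₂ lam β γ).transitionKernel L T T u.toNNReal z))
        ∂((pinnedChain ω₂ lam β γ).gibbsMeasure L T) :=
    greenKubo_forwardField hω hl hβ hγ hL hT (hg₀.of_le (by norm_cast)) hL2 hmean hpde'
  rw [kuboPairing_responseField hω hl hβ hγ hL hT hh (hg₀.of_le (by norm_cast)) hL2 hpde', hGK]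
  ring

/-- **The two fixed-`N` Kubo links of the crux agree.** For every `G`: a plain frame with coefficient `G`
exists iff `G = γ(1 − (γ/T²)⟨g, p_0² − T⟩_{μ_T})` for every classical forward field
`g ∈ plainForwardFields ω₂ lam β γ T L` of the left bath — for `G = D_L/(L−1)` this right-hand side is the
sibling stub `stub_plainKuboLink` of line `floating-probe-bypass-laplacian` (vocabulary unfolded), so the
two lines' fixed-`N` linear-response stubs are equivalent given the landed material. -/
theorem exists_plainFrame_iff_kuboLink (G : ℝ) :
    (∃ h : PhaseSpace L → ℝ, PlainFrame (pinnedChain ω₂ lam β γ) T L h G) ↔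
      ∀ g ∈ plainForwardFields ω₂ lam β γ T L,
        G = γ * (1 - γ / T ^ 2 * ∫ x, g x * (kin L 0 x - T) ∂((pinnedChain ω₂ lam β γ).gibbsMeasure L T)) := by
  rw [exists_plainFrame_iff hω hl hβ hγ hL hT G]
  constructor
  · rintro H g ⟨hC, hgL2, -, hpde⟩
    obtain ⟨h, hh⟩ := exists_isPlainResponseField hω hl hβ hγ hL hT
    rw [H h hh, kuboPairing_responseField hω hl hβ hγ hL hT hh hC hgL2 hpde]
    ring
  · intro H h hh
    obtain ⟨g₀, hg₀, hL2, hmean, hpde⟩ := exists_smooth_poisson hω hl hβ hγ hL hT (K := 2 / (1 / (4 * T)) + T)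
      (k := fun y : PhaseSpace L => y.2 ⟨0, hL⟩ ^ 2 - T) (by fun_prop)
      (fun y => abs_sq_momentum_sub_le_exp (γ := γ) hω hl hβ.le (by positivity) hT.le y ⟨0, hL⟩)
      (pinnedChain_integral_kinObs_gibbsMeasure hω hl hβ.le γ L hT ⟨0, hL⟩)
    have hpde' : ∀ x, (pinnedChain ω₂ lam β γ).generator L T T g₀ x = -(kin L 0 x - T) := fun x => by
      rw [hpde x, (show kin L 0 x = x.2 ⟨0, hL⟩ ^ 2 from kin_eq_sq hL x)]
    have hmem : g₀ ∈ plainForwardFields ω₂ lam β γ T L := ⟨hg₀.of_le (by norm_cast), hL2, hmean, hpde'⟩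
    rw [H g₀ hmem, kuboPairing_responseField hω hl hβ hγ hL hT hh (hg₀.of_le (by norm_cast)) hL2 hpde']
    ring

end KuboPairing

/-! ## The stub from the finite-volume linear-response identity -/

/-- **`stub_linearResponsePlain` at length `L`, from `ResponseIdentity` at length `L`.** Under the crux
frame, if the response quotient of the steady-state family at length `L ≥ 2` converges to
`(L−1)·γ·E_L` (the conclusion of route item `BoundaryEscapeDeficit.ResponseIdentity`,
stmt-AtomisticToContinuum-12237, at this `L`), then the plain frame holds with `G = D_L/(L−1)`:
uniqueness of limits along `𝓝[≠] 0` gives `D_L = (L−1)γE_L`, and `γE_L = γ(1/2 − ⟨p_0² − T, h⟩)` for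
the response field `h` (`responseCoefficient_eq_escapeDeficit`). -/
theorem plainFrame_of_responseIdentityAt (ω₂ lam β γ : ℝ) (μ : (N : ℕ) → ℝ → ℝ → Measure (PhaseSpace N))
    (T : ℝ) (D : ℕ → ℝ) (hF : CruxFrame ω₂ lam β γ μ T D) (L : ℕ) (hL2 : 2 ≤ L)
    (hRI : Tendsto (fun δ : ℝ => (pinnedChain ω₂ lam β γ).totalCurrent (μ L (T + δ / 2) (T - δ / 2)) / δ)
      (𝓝[≠] 0) (𝓝 (((L : ℝ) - 1) * γ * (1 - γ / T ^ 2 * ∫ u in Set.Ioi (0 : ℝ),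
        ∫ z, (z.2 ⟨0, by omega⟩ ^ 2 - T) * (∫ y, (y.2 ⟨0, by omega⟩ ^ 2 - T)
          ∂((pinnedChain ω₂ lam β γ).transitionKernel L T T u.toNNReal z))
          ∂((pinnedChain ω₂ lam β γ).gibbsMeasure L T))))) :
    ∃ h : PhaseSpace L → ℝ, PlainFrame (pinnedChain ω₂ lam β γ) T L h (D L / ((L : ℝ) - 1)) := by
  obtain ⟨hω, hlam, hβ, hγ, -, -, hT, hD, -⟩ := hF
  have hL : 0 < L := by omega
  have hDL := tendsto_nhds_unique (hD L) hRI
  refine (exists_plainFrame_iff hω hlam.le hβ hγ hL hT _).2 fun h hh => ?_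
  rw [responseCoefficient_eq_escapeDeficit hω hlam.le hβ hγ hL hT hh, hDL]
  have hL1 : ((L : ℝ) - 1) ≠ 0 := by
    have : (2 : ℝ) ≤ (L : ℝ) := by exact_mod_cast hL2
    linarith
  field_simp

/-- **`stub_linearResponsePlain` from `ResponseIdentity`** (route item stmt-AtomisticToContinuum-12237,
`BoundaryEscapeDeficit.ResponseIdentity`: the finite-volume linear-response identity
`totalCurrent(μ_{L,T+δ/2,T−δ/2})/δ → (L−1)·γ·E_L` along unique weak steady-state families): the registered
stub of the line, verbatim, follows. Everything else — existence and a.e.-uniqueness of the response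
field, the momentum-reversal/Onsager identities, the sum rule and the Green–Kubo identification — is
proved in the tree; the stub is thereby EXACTLY the open item 12237 read through this file. -/
theorem linearResponsePlain_of_responseIdentity
    (hRI : Summit.AtomisticToContinuum.FouriersLaw.Theses.BoundaryEscapeDeficit.ResponseIdentity) :
    ∀ (ω₂ lam β γ : ℝ) (μ : (N : ℕ) → ℝ → ℝ → Measure (PhaseSpace N)) (T : ℝ) (D : ℕ → ℝ),
      CruxFrame ω₂ lam β γ μ T D →
      ∀ L : ℕ, 2 ≤ L → ∃ h : PhaseSpace L → ℝ,
          PlainFrame (pinnedChain ω₂ lam β γ) T L h (D L / ((L : ℝ) - 1)) := by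
  intro ω₂ lam β γ μ T D hF L hL2
  have hL : 0 < L := by omega
  obtain ⟨hω, hlam, hβ, hγ, hU, hμ, hT, hD, -⟩ := id hF
  have hri := hRI ω₂ lam β γ hω hlam hβ hγ hU μ hμ T hT
  dsimp only at hri
  obtain ⟨-, hlim⟩ := hri L hL
  simp only [dif_pos hL] at hlim
  exact plainFrame_of_responseIdentityAt ω₂ lam β γ μ T D hF L hL2 hlim

/-! ## Registered helper sub-goal -/

/-- **Registered helper sub-goal of this file** (`helper_linearResponsePlainOfResponseIdentity`): the
registered stub `stub_linearResponsePlain` of the line, verbatim, from the route item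
`BoundaryEscapeDeficit.ResponseIdentity` (stmt-AtomisticToContinuum-12237)
(= `linearResponsePlain_of_responseIdentity`). -/
theorem helper_linearResponsePlainOfResponseIdentity : Summit.AtomisticToContinuum.FouriersLaw.Theses.BoundaryEscapeDeficit.ResponseIdentity → ∀ (ω₂ lam β γ : ℝ) (μ : (N : ℕ) → ℝ → ℝ → Measure (PhaseSpace N)) (T : ℝ) (D : ℕ → ℝ), CruxFrame ω₂ lam β γ μ T D → ∀ L : ℕ, 2 ≤ L → ∃ h : PhaseSpace L → ℝ, PlainFrame (pinnedChain ω₂ lam β γ) T L h (D L / ((L : ℝ) - 1)) :=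
  linearResponsePlain_of_responseIdentity

end Summit.AtomisticToContinuum.FouriersLaw.Cruxes.SuperadditiveResistance.ThermaliseThenCutProbeInsertion

end
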